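import Summits.CriticalPhenomena.PercolationContinuityZ3.Theorems.Transplant.BccSlabSqShadowCritical
import Summits.CriticalPhenomena.PercolationContinuityZ3.Theorems.Transplant.VPathKit
import HarnessLib

/-!
# Self-avoiding paths in the bcc (001)-slabs: generic vertex-list paths, explicit slab vertices `vtx q h`, and the LIFT of a planar lattice walk
# with a prescribed height profile (the tool-kit for the routing certificate `LocalLinkage` / `ShapedLinkageX R` of «BccSlabSqShadowCritical»)

builds on p205010 (kernel theorem, internal audit signed; external expert review pending) — NOT used in this file.  Lane `prim-bschramm`, seat
`prim-bschramm-p2` (gen 45; class C1b; memo `HOME/bschramm/P2-LATTICES.md` §155 (4)); helper file (`--supports stmt-CriticalPhenomena-4575 --as helper`).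

The routing node for the bcc slab (the one hypothesis left in `BccSlab.theta_criticalProb_eq_zero_of_shapedLinkageX` / `…_of_localLinkage`) asks for three
self-avoiding slab paths with prescribed end VERTICES inside prescribed COLUMN sets.  In `S_k(bcc)` every bond moves the shadow by a unit axis step AND the height
by `±1`, so a slab path over a planar lattice walk `π = (p₀, …, p_ℓ)` is the same thing as a HEIGHT PROFILE `(h₀, …, h_ℓ)` with `|h_{i+1} − h_i| = 1`,
`0 ≤ hᵢ ≤ k`, `hᵢ ≡ (pᵢ)₀ + (pᵢ)₁ (mod 2)`; it is self-avoiding as soon as `π` is (distinct columns) OR the profile is strictly monotone (distinct heights).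
Paths are the generic vertex lists `GPath` of «VPathKit» (gen 34).
* §2 `BccSlab.vtx k q h` — the slab vertex over `q` at height `h` (junk outside the admissible range), `sh_vtx`, `height_vtx`, `vtx_sh_height`, injectivity,
  **`adj_vtx`** (lattice-adjacent columns + heights differing by one ⇒ adjacent);
* §3 **`liftZip π hs`** — the lift of a planar walk with a height profile: a `GPath` of the slab when consecutive columns are lattice-adjacent, consecutive
  heights differ by one, all pairs admissible, and (`π` duplicate-free ∨ `hs` duplicate-free); its columns are those of `π`, its heights those of `hs`.
[cite: DuminilCopinSidoraviciusTassion2016, §2.3 (proof of Fact 2: the three disjoint paths γ_u, γ_v, γ_w)] [cite: ConwaySloane1999, Ch. 4 §7.1]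
-/

noncomputable section

namespace Summit.CriticalPhenomena.PercolationContinuityZ3.Theorems.Transplant

open Literature.Probability.Percolation Literature.Probability.LatticeModels SimpleGraph
open scoped Classical

namespace BccSlab

variable {k : ℕ}

/-! ## §2 Explicit slab vertices -/

/-- The height (third ambient coordinate) of a slab vertex. [folklore] -/
def ht (v : bslab k) : ℤ := ((v : bccSite) : Site 3) 2

/-- `(q, h)` is an admissible (column, height) pair of `S_k(bcc)`: `0 ≤ h ≤ k` and `h ≡ q₀ + q₁ (mod 2)`. [cite: ConwaySloane1999, Ch. 4 §7.1] -/
def Adm (k : ℕ) (q : Site 2) (h : ℤ) : Prop := 0 ≤ h ∧ h ≤ k ∧ Even (q 0 + q 1 - h)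

/-- **The slab vertex over `q` at height `h`** (the origin as junk value when `(q, h)` is not admissible). [cite: ConwaySloane1999, Ch. 4 §7.1] -/
def vtx (k : ℕ) (q : Site 2) (h : ℤ) : bslab k :=
  if hv : Adm k q h then mkV q h hv.2.2 hv.1 hv.2.1 else origin k

/-- The shadow of an admissible explicit vertex. [folklore] -/
theorem sh_vtx {q : Site 2} {h : ℤ} (hv : Adm k q h) : sh (vtx k q h) = q := by
  unfold vtx; rw [dif_pos hv]; exact sh_mkV _ _ _ _ _

/-- The height of an admissible explicit vertex. [folklore] -/
theorem ht_vtx {q : Site 2} {h : ℤ} (hv : Adm k q h) : ht (vtx k q h) = h := by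
  unfold vtx; rw [dif_pos hv]; rfl

/-- Every slab vertex has an admissible (shadow, height). [folklore] -/
theorem adm_sh_ht (v : bslab k) : Adm k (sh v) (ht v) :=
  ⟨(mem_bslab.1 v.2).1, (mem_bslab.1 v.2).2, even_sh_sum_sub_height v⟩

/-- Every slab vertex is the explicit vertex of its shadow and height. [folklore] -/
theorem vtx_sh_ht (v : bslab k) : vtx k (sh v) (ht v) = v :=
  eq_of_sh_eq_of_height_eq (sh_vtx (adm_sh_ht v)) (ht_vtx (adm_sh_ht v))

/-- Explicit vertices with admissible data are equal iff the data are. [folklore] -/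
theorem vtx_eq_vtx_iff {q q' : Site 2} {h h' : ℤ} (hv : Adm k q h) (hv' : Adm k q' h') : vtx k q h = vtx k q' h' ↔ q = q' ∧ h = h' := by
  constructor
  · intro e
    exact ⟨by rw [← sh_vtx hv, e, sh_vtx hv'], by rw [← ht_vtx hv, e, ht_vtx hv']⟩
  · rintro ⟨rfl, rfl⟩; rfl

/-- Adjacency from the three coordinate differences `±1`. [cite: ConwaySloane1999, Ch. 4 §7.1 (the eight neighbours (±1,±1,±1))] -/
theorem adj_of_abs_sub_eq_one {x y : bslab k} (h : ∀ i : Fin 3, |((x : bccSite) : Site 3) i - ((y : bccSite) : Site 3) i| = 1) : (slabGraph k).Adj x y := by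
  rw [slabGraph_adj, bccGraph_adj]
  have hsq : ∀ i : Fin 3, (((x : bccSite) : Site 3) i - ((y : bccSite) : Site 3) i) ^ 2 = 1 := fun i => by
    rw [← sq_abs, h i, one_pow]
  refine ⟨fun hxy => ?_, by rw [Fin.sum_univ_three, hsq 0, hsq 1, hsq 2]; norm_num⟩
  have := h 0
  rw [hxy, sub_self, abs_zero] at this
  exact zero_ne_one this

/-- **Adjacency of explicit vertices**: lattice-adjacent columns and heights differing by one. [cite: ConwaySloane1999, Ch. 4 §7.1] -/
theorem adj_vtx {q q' : Site 2} {h h' : ℤ} (hv : Adm k q h) (hv' : Adm k q' h') (hq : (zdGraph 2).Adj q q') (hh : h' = h + 1 ∨ h' = h - 1) :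
    (slabGraph k).Adj (vtx k q h) (vtx k q' h') := by
  apply adj_of_abs_sub_eq_one
  have ex0 := bcc_coord_zero_eq ((vtx k q h : bslab k) : bccSite)
  have ex1 := bcc_coord_one_eq ((vtx k q h : bslab k) : bccSite)
  have ey0 := bcc_coord_zero_eq ((vtx k q' h' : bslab k) : bccSite)
  have ey1 := bcc_coord_one_eq ((vtx k q' h' : bslab k) : bccSite)
  have sx : bccSkel ((vtx k q h : bslab k) : bccSite) = q := sh_vtx hv
  have sy : bccSkel ((vtx k q' h' : bslab k) : bccSite) = q' := sh_vtx hv'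
  have tx : (((vtx k q h : bslab k) : bccSite) : Site 3) 2 = h := ht_vtx hv
  have ty : (((vtx k q' h' : bslab k) : bccSite) : Site 3) 2 = h' := ht_vtx hv'
  rw [sx] at ex0 ex1
  rw [sy] at ey0 ey1
  obtain ⟨j, hj | hj⟩ := (zdGraph_adj_iff _ _).1 hq
  all_goals
    have c0 := congrFun hj 0; have c1 := congrFun hj 1
    simp only [Pi.add_apply] at c0 c1
    intro i
    fin_cases i
    · show |(((vtx k q h : bslab k) : bccSite) : Site 3) 0 - (((vtx k q' h' : bslab k) : bccSite) : Site 3) 0| = 1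
      rw [ex0, ey0]
      fin_cases j <;> simp at c0 c1 <;> rw [abs_eq (zero_le_one' ℤ)] <;> omega
    · show |(((vtx k q h : bslab k) : bccSite) : Site 3) 1 - (((vtx k q' h' : bslab k) : bccSite) : Site 3) 1| = 1
      rw [ex1, ey1]
      fin_cases j <;> simp at c0 c1 <;> rw [abs_eq (zero_le_one' ℤ)] <;> omega
    · show |(((vtx k q h : bslab k) : bccSite) : Site 3) 2 - (((vtx k q' h' : bslab k) : bccSite) : Site 3) 2| = 1
      rw [tx, ty, abs_eq (zero_le_one' ℤ)]; omega

/-! ## §3 The lift of a planar walk with a height profile -/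

/-- **The lift**: the vertex list over the columns `π` at the heights `hs` (zipped; junk where not admissible). [cite: DuminilCopinSidoraviciusTassion2016, §2.3] -/
def liftZip (k : ℕ) (π : List (Site 2)) (hs : List ℤ) : List (bslab k) := List.zipWith (vtx k) π hs

/-- Length of the lift. [folklore] -/
theorem length_liftZip (π : List (Site 2)) (hs : List ℤ) (hlen : π.length = hs.length) : (liftZip k π hs).length = π.length := by
  rw [liftZip, List.length_zipWith, hlen, min_self]

/-- Entries of the lift. [folklore] -/
theorem getElem_liftZip (π : List (Site 2)) (hs : List ℤ) (i : ℕ) (hi : i < (liftZip k π hs).length) :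
    (liftZip k π hs)[i] = vtx k (π[i]'(lt_min_iff.1 (List.length_zipWith (f := vtx k) ▸ hi)).1) (hs[i]'(lt_min_iff.1 (List.length_zipWith (f := vtx k) ▸ hi)).2) := by
  simp only [liftZip, List.getElem_zipWith]

/-- Members of the lift are explicit vertices over a column of `π` at the height of the same index. [folklore] -/
theorem mem_liftZip_iff {π : List (Site 2)} {hs : List ℤ} {v : bslab k} :
    v ∈ liftZip k π hs ↔ ∃ (i : ℕ) (hi : i < π.length) (hi' : i < hs.length), v = vtx k π[i] hs[i] := by
  rw [List.mem_iff_getElem]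
  constructor
  · rintro ⟨i, hi, rfl⟩
    have hi2 := hi
    rw [liftZip, List.length_zipWith] at hi2
    exact ⟨i, (lt_min_iff.1 hi2).1, (lt_min_iff.1 hi2).2, by rw [getElem_liftZip]⟩
  · rintro ⟨i, hi, hi', rfl⟩
    refine ⟨i, by rw [liftZip, List.length_zipWith]; exact lt_min hi hi', ?_⟩
    rw [getElem_liftZip]

/-- The head of the lift. [folklore] -/
theorem head_liftZip {π : List (Site 2)} {hs : List ℤ} (hπ : π ≠ []) (hhs : hs ≠ []) (hne : liftZip k π hs ≠ []) :
    (liftZip k π hs).head hne = vtx k (π.head hπ) (hs.head hhs) := by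
  cases π with
  | nil => exact absurd rfl hπ
  | cons p ps =>
    cases hs with
    | nil => exact absurd rfl hhs
    | cons h hs' => rfl

/-- The last vertex of the lift. [folklore] -/
theorem getLast_liftZip : ∀ {π : List (Site 2)} {hs : List ℤ} (_ : π.length = hs.length) (hπ : π ≠ []) (hhs : hs ≠ []) (hne : liftZip k π hs ≠ []),
    (liftZip k π hs).getLast hne = vtx k (π.getLast hπ) (hs.getLast hhs)
  | [], _, _, hπ, _, _ => absurd rfl hπ
  | _ :: _, [], _, _, hhs, _ => absurd rfl hhs
  | [p], [h], _, _, _, _ => rfl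
  | [_], _ :: _ :: _, hlen, _, _, _ => by simp at hlen
  | _ :: _ :: _, [_], hlen, _, _, _ => by simp at hlen
  | p :: p' :: ps, h :: h' :: hs', hlen, _, _, _ => by
    have hlen' : (p' :: ps).length = (h' :: hs').length := by simpa using hlen
    have hne' : liftZip k (p' :: ps) (h' :: hs') ≠ [] := by simp [liftZip]
    have e1 : liftZip k (p :: p' :: ps) (h :: h' :: hs') = vtx k p h :: liftZip k (p' :: ps) (h' :: hs') := rfl
    simp only [e1, List.getLast_cons hne', List.getLast_cons_cons]
    exact getLast_liftZip hlen' (List.cons_ne_nil _ _) (List.cons_ne_nil _ _) hne'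

/-- **A height profile is admissible for `π`**: same length, every pair admissible, consecutive heights differ by one. [folklore] -/
structure Profile (k : ℕ) (π : List (Site 2)) (hs : List ℤ) : Prop where
  /-- same length -/
  len : π.length = hs.length
  /-- admissible pairs -/
  adm : ∀ (i : ℕ) (hi : i < π.length) (hi' : i < hs.length), Adm k π[i] hs[i]
  /-- unit height steps -/
  step : ∀ (i : ℕ) (hi : i + 1 < hs.length), hs[i + 1] = hs[i]'(Nat.lt_of_succ_lt hi) + 1 ∨ hs[i + 1] = hs[i]'(Nat.lt_of_succ_lt hi) - 1

/-- **THE LIFT IS A SELF-AVOIDING SLAB PATH** when `π` is a non-empty lattice walk, `hs` an admissible profile, and `π` or `hs` is duplicate-free; it runs from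
`vtx (π.head) (hs.head)` to `vtx (π.last) (hs.last)`. [cite: DuminilCopinSidoraviciusTassion2016, §2.3 (proof of Fact 2)] -/
theorem gpath_liftZip {π : List (Site 2)} {hs : List ℤ} (hπ : π ≠ []) (hhs : hs ≠ [])
    (hwalk : π.IsChain (fun a b => (zdGraph 2).Adj a b)) (hP : Profile k π hs) (hnd : π.Nodup ∨ hs.Nodup) :
    GPath (slabGraph k) (liftZip k π hs) (vtx k (π.head hπ) (hs.head hhs)) (vtx k (π.getLast hπ) (hs.getLast hhs)) := by
  have hlen := hP.len
  have hL := length_liftZip (k := k) π hs hlen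
  have hne : liftZip k π hs ≠ [] := by
    intro h; have := congrArg List.length h
    rw [hL, List.length_nil] at this
    exact hπ (List.eq_nil_of_length_eq_zero this)
  refine ⟨hne, ?_, ?_, ?_, ?_⟩
  · -- chain
    rw [List.isChain_iff_getElem]
    intro i hi
    rw [getElem_liftZip, getElem_liftZip]
    have hi1 : i + 1 < π.length := by rw [hL] at hi; exact hi
    exact adj_vtx (hP.adm i (by omega) (by omega)) (hP.adm (i + 1) hi1 (by omega)) (List.isChain_iff_getElem.1 hwalk i hi1)
      (hP.step i (by omega))
  · -- nodup
    rw [List.nodup_iff_injective_get]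
    intro ⟨i, hi⟩ ⟨j, hj⟩ hij
    simp only [List.get_eq_getElem, getElem_liftZip] at hij
    have hi' : i < π.length := by rw [hL] at hi; exact hi
    have hj' : j < π.length := by rw [hL] at hj; exact hj
    rw [vtx_eq_vtx_iff (hP.adm i hi' (by omega)) (hP.adm j hj' (by omega))] at hij
    rcases hnd with hnd | hnd
    · exact Fin.ext ((List.Nodup.getElem_inj_iff hnd).1 hij.1)
    · exact Fin.ext ((List.Nodup.getElem_inj_iff hnd).1 hij.2)
  · rw [List.head?_eq_some_head hne, head_liftZip hπ hhs hne]
  · rw [List.getLast?_eq_some_getLast hne, getLast_liftZip hlen hπ hhs hne]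

/-- The columns of the lift are columns of `π`. [folklore] -/
theorem sh_mem_of_mem_liftZip {π : List (Site 2)} {hs : List ℤ} (hP : Profile k π hs) {v : bslab k} (hv : v ∈ liftZip k π hs) : sh v ∈ π := by
  obtain ⟨i, hi, hi', rfl⟩ := mem_liftZip_iff.1 hv
  rw [sh_vtx (hP.adm i hi hi')]
  exact List.getElem_mem _

/-- The heights of the lift are heights of `hs`. [folklore] -/
theorem ht_mem_of_mem_liftZip {π : List (Site 2)} {hs : List ℤ} (hP : Profile k π hs) {v : bslab k} (hv : v ∈ liftZip k π hs) : ht v ∈ hs := by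
  obtain ⟨i, hi, hi', rfl⟩ := mem_liftZip_iff.1 hv
  rw [ht_vtx (hP.adm i hi hi')]
  exact List.getElem_mem _

end BccSlab

end Summit.CriticalPhenomena.PercolationContinuityZ3.Theorems.Transplant

end
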